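import Summits.AtomisticToContinuum.Crystallization.Theses.HolmgrenBoyleLind
import Summits.AtomisticToContinuum.Crystallization.Theorems.HolmgrenBoyleLindFiniteRigidityVanishing
import Summits.AtomisticToContinuum.Crystallization.Theorems.HolmgrenBoyleLindFiniteRigidityKernel

/-!
# Route `HolmgrenBoyleLind`: proof of `FiniteRigidity` (stmt-AtomisticToContinuum-6078)

«A local rearrangement cannot hide from infinity.»  Let `Λ ⊂ ℝ³` be `r`-dense and in exact
Lennard-Jones force balance, and let `Λ' ≠ Λ` differ from `Λ` in finitely many points
(`T = Λ' ∆ Λ`, finite and non-empty).  If every point of `Λ'` were balanced too, then at every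
`x ∈ Λ ∩ Λ'` the two balance identities differ by the force field
`Φ(x) = Σ_{y ∈ T} c_y K(x − y)` (`c = +1` on `Λ' ∖ Λ`, `−1` on `Λ ∖ Λ'`,
`K(v) = ((‖v‖²)⁻⁴ − (‖v‖²)⁻⁷) v`) of the finite signed source `T`, so `Φ = 0` on `Λ ∩ Λ'`
(`signedSum_eq_zero_of_hasSum`).  Since `Λ ∩ Λ'` is `Λ` minus finitely many points, every unit
vector is a limit direction of it at infinity (`directions_of_dense`), so `Φ ≡ 0` outside a large
ball (`farField_eq_zero`: Kelvin inversion + Taylor diagonals); `Φ` is real-analytic on the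
connected open set `ℝ³ ∖ T`, hence `Φ ≡ 0` there (Mathlib's identity theorem
`AnalyticOnNhd.eqOn_zero_of_preconnected_of_eventuallyEq_zero`), contradicting the `‖v‖⁻¹³`
blow-up of `K` at a source `y₀ ∈ T` (`inv_norm_le_norm_kernel`).  The separation hypothesis is
not needed.  [cite: BlancLewin2015, §2.3] for the setting; the argument is `[folklore]`.
-/

noncomputable section

namespace Summit.AtomisticToContinuum.Crystallization.Theorems.HolmgrenBoyleLind

open scoped BigOperators Topology InnerProductSpace
open Filter Set
open Literature.MathematicalPhysics.StatisticalMechanics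

/-! ## The far field of a finite signed source -/

/-- **A finite signed source cannot hide from infinity.** If the force field
`Φ(x) = Σ_{y ∈ T} c_y K(x − y)` of a finite signed source vanishes on a set `D` for which every
unit vector is a limit of directions `x/‖x‖`, `x ∈ D`, `‖x‖ → ∞`, then `Φ` vanishes identically
outside a large ball: its Kelvin transform is real-analytic at `0` and all its Taylor diagonals
die degree by degree (`eventuallyEq_zero_of_directions`). [folklore] -/
theorem farField_eq_zero (T : Finset (EuclideanSpace ℝ (Fin 3))) (c : EuclideanSpace ℝ (Fin 3) → ℝ)
    (D : Set (EuclideanSpace ℝ (Fin 3)))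
    (hD : ∀ x ∈ D,
      (∑ y ∈ T, c y • ((((‖x - y‖ ^ 2) ^ 4)⁻¹ - ((‖x - y‖ ^ 2) ^ 7)⁻¹) • (x - y))) = 0)
    (hdir : ∀ ω : EuclideanSpace ℝ (Fin 3), ‖ω‖ = 1 → ∀ ε : ℝ, 0 < ε →
      ∃ x ∈ D, x ≠ 0 ∧ ‖x‖⁻¹ < ε ∧ ‖‖x‖⁻¹ • x - ω‖ < ε) :
    ∃ R : ℝ, 0 < R ∧ ∀ x : EuclideanSpace ℝ (Fin 3), R < ‖x‖ →
      (∑ y ∈ T, c y • ((((‖x - y‖ ^ 2) ^ 4)⁻¹ - ((‖x - y‖ ^ 2) ^ 7)⁻¹) • (x - y))) = 0 := by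
  -- the Kelvin transform of `Φ`
  set Ψ : EuclideanSpace ℝ (Fin 3) → EuclideanSpace ℝ (Fin 3) := fun u => ∑ y ∈ T, c y •
    (((‖u‖ ^ 2) ^ 3 * ((1 - 2 * ⟪u, y⟫_ℝ + ‖y‖ ^ 2 * ‖u‖ ^ 2) ^ 4)⁻¹ -
        (‖u‖ ^ 2) ^ 6 * ((1 - 2 * ⟪u, y⟫_ℝ + ‖y‖ ^ 2 * ‖u‖ ^ 2) ^ 7)⁻¹) •
      (u - ‖u‖ ^ 2 • y)) with hΨ
  have hΨan : AnalyticAt ℝ Ψ 0 :=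
    Finset.analyticAt_fun_sum T fun y _ => analyticAt_const.fun_smul (analyticAt_kernel_kelvin y)
  have hΨΦ : ∀ u : EuclideanSpace ℝ (Fin 3), u ≠ 0 → Ψ u = ∑ y ∈ T, c y •
      ((((‖(‖u‖ ^ 2)⁻¹ • u - y‖ ^ 2) ^ 4)⁻¹ - ((‖(‖u‖ ^ 2)⁻¹ • u - y‖ ^ 2) ^ 7)⁻¹) •
        ((‖u‖ ^ 2)⁻¹ • u - y)) := by
    intro u hu
    simp only [hΨ]
    exact Finset.sum_congr rfl fun y _ => by rw [kernel_kelvin u y hu]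
  set S : Set (EuclideanSpace ℝ (Fin 3)) := {u | u ≠ 0 ∧ (‖u‖ ^ 2)⁻¹ • u ∈ D}
  have hS : ∀ u ∈ S, Ψ u = 0 := by
    intro u hu
    rw [hΨΦ u hu.1]
    exact hD _ hu.2
  have hdirS : ∀ ω : EuclideanSpace ℝ (Fin 3), ‖ω‖ = 1 → ∀ ε : ℝ, 0 < ε →
      ∃ u ∈ S, u ≠ 0 ∧ ‖u‖ < ε ∧ ‖‖u‖⁻¹ • u - ω‖ < ε := by
    intro ω hω ε hε
    obtain ⟨x, hxD, hx0, hxε, hxdir⟩ := hdir ω hω ε hε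
    refine ⟨(‖x‖ ^ 2)⁻¹ • x, ⟨kelvin_ne_zero hx0, ?_⟩, kelvin_ne_zero hx0, ?_, ?_⟩
    · show (‖(‖x‖ ^ 2)⁻¹ • x‖ ^ 2)⁻¹ • ((‖x‖ ^ 2)⁻¹ • x) ∈ D
      rw [kelvin_kelvin hx0]
      exact hxD
    · rw [norm_kelvin hx0]
      exact hxε
    · rw [dir_kelvin hx0]
      exact hxdir
  have hev := eventuallyEq_zero_of_directions hΨan hS hdirS
  obtain ⟨ε, hε, hball⟩ := Metric.eventually_nhds_iff.1 hev
  refine ⟨ε⁻¹, inv_pos.2 hε, fun x hx => ?_⟩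
  have hx0 : x ≠ 0 := norm_pos_iff.1 (lt_trans (inv_pos.2 hε) hx)
  have h1 : Ψ ((‖x‖ ^ 2)⁻¹ • x) = 0 := by
    have := hball (y := (‖x‖ ^ 2)⁻¹ • x)
      (by rw [dist_zero_right, norm_kelvin hx0]; exact inv_lt_of_inv_lt₀ hε hx)
    simpa using this
  rw [hΨΦ _ (kelvin_ne_zero hx0), kelvin_kelvin hx0] at h1
  exact h1

/-! ## Bookkeeping, limit directions, and the proof -/

open Classical in
/-- **Bookkeeping.** If `x ∈ Λ ∩ Λ'` is balanced in `Λ` and in `Λ'` for a summand `F`, and `T` is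
the symmetric difference `Λ' ∆ Λ`, then the signed finite sum `Σ_{y ∈ T} c_y F(y)` vanishes
(`c = +1` on `Λ'`, `−1` off `Λ'`). [folklore] -/
theorem signedSum_eq_zero_of_hasSum {Λ Λ' : Set (EuclideanSpace ℝ (Fin 3))}
    {T : Finset (EuclideanSpace ℝ (Fin 3))}
    (hT : ∀ y, y ∈ T ↔ (y ∈ Λ' ∧ y ∉ Λ) ∨ (y ∈ Λ ∧ y ∉ Λ'))
    (F : EuclideanSpace ℝ (Fin 3) → EuclideanSpace ℝ (Fin 3)) {x : EuclideanSpace ℝ (Fin 3)}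
    (hxΛ : x ∈ Λ) (hxΛ' : x ∈ Λ')
    (h1 : HasSum (fun y : {y : EuclideanSpace ℝ (Fin 3) // y ∈ Λ ∧ y ≠ x} => F y) 0)
    (h2 : HasSum (fun y : {y : EuclideanSpace ℝ (Fin 3) // y ∈ Λ' ∧ y ≠ x} => F y) 0) :
    (∑ y ∈ T, (if y ∈ Λ' then (1 : ℝ) else -1) • F y) = 0 := by
  classical
  set S₁ : Set (EuclideanSpace ℝ (Fin 3)) := {y | y ∈ Λ ∧ y ≠ x} with hS₁
  set S₂ : Set (EuclideanSpace ℝ (Fin 3)) := {y | y ∈ Λ' ∧ y ≠ x} with hS₂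
  have h1' : HasSum (S₁.indicator F) 0 := (hasSum_subtype_iff_indicator (s := S₁) (f := F)).1 h1
  have h2' : HasSum (S₂.indicator F) 0 := (hasSum_subtype_iff_indicator (s := S₂) (f := F)).1 h2
  set g : EuclideanSpace ℝ (Fin 3) → EuclideanSpace ℝ (Fin 3) := fun y =>
    S₂.indicator F y - S₁.indicator F y with hg
  have hdiff : HasSum g 0 := by
    have := h2'.sub h1'
    rwa [sub_zero] at this
  -- the difference has finite support `T`
  have hgT : ∀ y ∉ T, g y = 0 := by
    intro y hy
    rw [hT] at hy
    push Not at hy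
    by_cases hyΛ : y ∈ Λ
    · have hyΛ' : y ∈ Λ' := hy.2 hyΛ
      simp [hg, hS₁, hS₂, Set.indicator, hyΛ, hyΛ']
    · have hyΛ' : y ∉ Λ' := fun h => hyΛ (hy.1 h)
      simp [hg, hS₁, hS₂, Set.indicator, hyΛ, hyΛ']
  have hsum : HasSum g (∑ y ∈ T, g y) := hasSum_sum_of_ne_finset_zero hgT
  rw [← hsum.unique hdiff]
  refine Finset.sum_congr rfl fun y hy => ?_
  rw [hT] at hy
  rcases hy with ⟨hyΛ', hyΛ⟩ | ⟨hyΛ, hyΛ'⟩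
  · have hyx : y ≠ x := fun h => hyΛ (h ▸ hxΛ)
    simp [hg, hS₁, hS₂, Set.indicator, hyΛ', hyΛ, hyx]
  · have hyx : y ≠ x := fun h => hyΛ' (h ▸ hxΛ')
    simp [hg, hS₁, hS₂, Set.indicator, hyΛ', hyΛ, hyx]

/-- **Every direction is a limit direction.** If `Λ` is `r`-dense in `ℝ³` and `T` is finite,
then for every unit vector `ω` and every `ε > 0` there is `x ∈ Λ ∖ T` with `‖x‖ > 1/ε` and
`‖x/‖x‖ − ω‖ < ε`. [folklore] -/
theorem directions_of_dense {Λ : Set (EuclideanSpace ℝ (Fin 3))} {r : ℝ}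
    (hden : ∀ c : EuclideanSpace ℝ (Fin 3), ∃ y ∈ Λ, dist y c ≤ r)
    (T : Finset (EuclideanSpace ℝ (Fin 3))) :
    ∀ ω : EuclideanSpace ℝ (Fin 3), ‖ω‖ = 1 → ∀ ε : ℝ, 0 < ε →
      ∃ x ∈ {x : EuclideanSpace ℝ (Fin 3) | x ∈ Λ ∧ x ∉ T},
        x ≠ 0 ∧ ‖x‖⁻¹ < ε ∧ ‖‖x‖⁻¹ • x - ω‖ < ε := by
  intro ω hω ε hε
  have hr : 0 ≤ r := by
    obtain ⟨y, -, hy⟩ := hden 0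
    exact dist_nonneg.trans hy
  set M : ℝ := ∑ y ∈ T, ‖y‖ with hM
  have hM0 : 0 ≤ M := by
    rw [hM]
    exact Finset.sum_nonneg fun y _ => norm_nonneg y
  have hMε : 0 ≤ M * ε := mul_nonneg hM0 hε.le
  set K : ℝ := 2 * r / ε + 1 / ε + M + 1 with hK
  have hKε : K * ε = 2 * r + 1 + M * ε + ε := by
    rw [hK]
    calc (2 * r / ε + 1 / ε + M + 1) * ε = 2 * r * (ε⁻¹ * ε) + ε⁻¹ * ε + M * ε + ε := by ring
      _ = 2 * r + 1 + M * ε + ε := by rw [inv_mul_cancel₀ hε.ne']; ring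
  have hKpos : 0 < K := by
    have : 0 < K * ε := by rw [hKε]; linarith
    exact pos_of_mul_pos_left this hε.le
  set t : ℝ := r + K with ht
  have ht0 : 0 ≤ t := by
    rw [ht]
    linarith
  obtain ⟨x, hxΛ, hxdist⟩ := hden (t • ω)
  have htω : ‖t • ω‖ = t := by
    rw [norm_smul, hω, mul_one, Real.norm_of_nonneg ht0]
  have habs : |t - ‖x‖| ≤ r := by
    have := abs_norm_sub_norm_le (t • ω) x
    rw [htω, ← dist_eq_norm, dist_comm] at this
    exact this.trans hxdist
  have hxK : K ≤ ‖x‖ := by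
    have := (abs_le.1 habs).2
    linarith
  have hxpos : 0 < ‖x‖ := hKpos.trans_le hxK
  have hx0 : x ≠ 0 := norm_pos_iff.1 hxpos
  have hinvK : ‖x‖⁻¹ ≤ K⁻¹ := inv_anti₀ hKpos hxK
  refine ⟨x, ⟨hxΛ, ?_⟩, hx0, ?_, ?_⟩
  · intro hxT
    have : ‖x‖ ≤ M := Finset.single_le_sum (f := fun y => ‖y‖) (fun y _ => norm_nonneg y) hxT
    have h1 : 0 ≤ 2 * r / ε := by positivity
    have h2 : 0 < 1 / ε := by positivity
    linarith
  · refine lt_of_le_of_lt hinvK ?_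
    rw [inv_lt_iff_one_lt_mul₀ hKpos, mul_comm, hKε]
    linarith
  · have hdecomp : ‖x‖⁻¹ • x - ω = ‖x‖⁻¹ • (x - ‖x‖ • ω) := by
      rw [smul_sub, smul_smul, inv_mul_cancel₀ hxpos.ne', one_smul]
    have hnum : ‖x - ‖x‖ • ω‖ ≤ 2 * r := by
      calc ‖x - ‖x‖ • ω‖ = ‖(x - t • ω) + (t - ‖x‖) • ω‖ := by
            congr 1
            rw [sub_smul]
            abel
        _ ≤ ‖x - t • ω‖ + ‖(t - ‖x‖) • ω‖ := norm_add_le _ _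
        _ ≤ r + r := by
            gcongr
            · rwa [← dist_eq_norm]
            · rw [norm_smul, hω, mul_one, Real.norm_eq_abs]
              exact habs
        _ = 2 * r := by ring
    rw [hdecomp, norm_smul, norm_inv, norm_norm]
    calc ‖x‖⁻¹ * ‖x - ‖x‖ • ω‖ ≤ K⁻¹ * (2 * r) :=
          mul_le_mul hinvK hnum (norm_nonneg _) (inv_nonneg.2 hKpos.le)
      _ < ε := by
          rw [inv_mul_lt_iff₀ hKpos, hKε]
          linarith

/-- **`FiniteRigidity`** (item stmt-AtomisticToContinuum-6078 of route `HolmgrenBoyleLind`): an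
`r`-dense subset of `ℝ³` in exact Lennard-Jones force balance admits no balanced modification in
finitely many points — the force field of the finite signed source `Λ' ∆ Λ` would vanish on
`Λ ∩ Λ'`, hence (Kelvin inversion, Taylor diagonals, identity theorem) on all of `ℝ³ ∖ (Λ' ∆ Λ)`,
contradicting the `r⁻¹³` core at a source. [cite: BlancLewin2015, §2.3] -/
theorem finiteRigidity_proof :
    Summit.AtomisticToContinuum.Crystallization.Theses.HolmgrenBoyleLind.FiniteRigidity := by
  unfold Summit.AtomisticToContinuum.Crystallization.Theses.HolmgrenBoyleLind.FiniteRigidity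
  intro Λ δ r _hδ _hr _hsep hden hbal Λ' hfin hne
  classical
  by_contra hcon
  push Not at hcon
  -- the finite signed source `T = Λ' ∆ Λ` with signs `c`
  set T : Finset (EuclideanSpace ℝ (Fin 3)) := hfin.toFinset with hTdef
  have hT : ∀ y, y ∈ T ↔ (y ∈ Λ' ∧ y ∉ Λ) ∨ (y ∈ Λ ∧ y ∉ Λ') := by
    intro y
    rw [hTdef, Set.Finite.mem_toFinset]
    simp only [Set.mem_union, Set.mem_sdiff]
  set c : EuclideanSpace ℝ (Fin 3) → ℝ := fun y => if y ∈ Λ' then (1 : ℝ) else -1 with hc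
  set Φ : EuclideanSpace ℝ (Fin 3) → EuclideanSpace ℝ (Fin 3) := fun z =>
    ∑ y ∈ T, c y • ((((‖z - y‖ ^ 2) ^ 4)⁻¹ - ((‖z - y‖ ^ 2) ^ 7)⁻¹) • (z - y)) with hΦ
  -- (1) `Φ` vanishes on `Λ ∖ T = Λ ∩ Λ'`
  have hD : ∀ x ∈ {x : EuclideanSpace ℝ (Fin 3) | x ∈ Λ ∧ x ∉ T}, Φ x = 0 := by
    rintro x ⟨hxΛ, hxT⟩
    have hxΛ' : x ∈ Λ' := by
      by_contra h
      exact hxT ((hT x).2 (Or.inr ⟨hxΛ, h⟩))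
    have h1 := hbal x hxΛ
    have h2 := hcon x hxΛ'
    have e1 : (fun y : {y : EuclideanSpace ℝ (Fin 3) // y ∈ Λ ∧ y ≠ x} =>
        (deriv lennardJones (dist x y) / dist x y) • (x - y)) =
        fun y : {y : EuclideanSpace ℝ (Fin 3) // y ∈ Λ ∧ y ≠ x} =>
          (((‖x - y‖ ^ 2) ^ 4)⁻¹ - ((‖x - y‖ ^ 2) ^ 7)⁻¹) • (x - y) :=
      funext fun y => ljForce_eq_kernel y.2.2
    have e2 : (fun y : {y : EuclideanSpace ℝ (Fin 3) // y ∈ Λ' ∧ y ≠ x} =>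
        (deriv lennardJones (dist x y) / dist x y) • (x - y)) =
        fun y : {y : EuclideanSpace ℝ (Fin 3) // y ∈ Λ' ∧ y ≠ x} =>
          (((‖x - y‖ ^ 2) ^ 4)⁻¹ - ((‖x - y‖ ^ 2) ^ 7)⁻¹) • (x - y) :=
      funext fun y => ljForce_eq_kernel y.2.2
    rw [e1] at h1
    rw [e2] at h2
    exact signedSum_eq_zero_of_hasSum hT
      (fun y => (((‖x - y‖ ^ 2) ^ 4)⁻¹ - ((‖x - y‖ ^ 2) ^ 7)⁻¹) • (x - y)) hxΛ hxΛ' h1 h2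
  -- (2) `Φ` vanishes outside a large ball
  obtain ⟨R, hRpos, hfar⟩ :=
    farField_eq_zero T c {x : EuclideanSpace ℝ (Fin 3) | x ∈ Λ ∧ x ∉ T} hD
      (directions_of_dense hden T)
  -- (3) identity theorem on the connected open set `ℝ³ ∖ T`
  have hΦan : AnalyticOnNhd ℝ Φ ((↑T : Set (EuclideanSpace ℝ (Fin 3)))ᶜ) := by
    intro z hz
    refine Finset.analyticAt_fun_sum T fun y hy =>
      analyticAt_const.fun_smul (analyticAt_kernel_sub y ?_)
    rintro rfl
    exact hz (Finset.mem_coe.2 hy)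
  have hU : IsPreconnected ((↑T : Set (EuclideanSpace ℝ (Fin 3)))ᶜ) :=
    (Set.Countable.isConnected_compl_of_one_lt_rank (by
        rw [← Module.finrank_eq_rank, finrank_euclideanSpace_fin]
        norm_num) T.countable_toSet).isPreconnected
  set M : ℝ := ∑ y ∈ T, ‖y‖ + R + 1 with hM
  have hM0 : 0 ≤ ∑ y ∈ T, ‖y‖ := Finset.sum_nonneg fun y _ => norm_nonneg y
  have hMpos : 0 < M := by
    rw [hM]
    linarith
  set e : EuclideanSpace ℝ (Fin 3) := EuclideanSpace.single (0 : Fin 3) (1 : ℝ) with he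
  have henorm : ‖e‖ = 1 := by
    rw [he]
    simp
  set z₀ : EuclideanSpace ℝ (Fin 3) := M • e with hz₀
  have hz₀norm : ‖z₀‖ = M := by
    rw [hz₀, norm_smul, henorm, mul_one, Real.norm_of_nonneg hMpos.le]
  have hz₀U : z₀ ∈ ((↑T : Set (EuclideanSpace ℝ (Fin 3)))ᶜ) := by
    intro hz
    have : ‖z₀‖ ≤ ∑ y ∈ T, ‖y‖ :=
      Finset.single_le_sum (f := fun y => ‖y‖) (fun y _ => norm_nonneg y) (Finset.mem_coe.1 hz)
    rw [hz₀norm] at this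
    linarith
  have hΦz₀ : Φ =ᶠ[𝓝 z₀] 0 := by
    have hopen : IsOpen {z : EuclideanSpace ℝ (Fin 3) | R < ‖z‖} :=
      isOpen_lt continuous_const continuous_norm
    have hmem : z₀ ∈ {z : EuclideanSpace ℝ (Fin 3) | R < ‖z‖} := by
      show R < ‖z₀‖
      rw [hz₀norm]
      linarith
    filter_upwards [hopen.mem_nhds hmem] with z hz
    exact hfar z hz
  have hΦU : EqOn Φ 0 ((↑T : Set (EuclideanSpace ℝ (Fin 3)))ᶜ) :=
    hΦan.eqOn_zero_of_preconnected_of_eventuallyEq_zero hU hz₀U hΦz₀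
  -- (4) contradiction with the blow-up at a source `y₀ ∈ T`
  have hTne : T.Nonempty := by
    rw [Finset.nonempty_iff_ne_empty]
    intro hT0
    apply hne
    ext y
    have hy := hT y
    rw [hT0] at hy
    simp only [Finset.notMem_empty, false_iff, not_or, not_and, not_not] at hy
    exact ⟨hy.1, hy.2⟩
  obtain ⟨y₀, hy₀⟩ := hTne
  set Rst : EuclideanSpace ℝ (Fin 3) → EuclideanSpace ℝ (Fin 3) := fun z => ∑ y ∈ T.erase y₀,
    c y • ((((‖z - y‖ ^ 2) ^ 4)⁻¹ - ((‖z - y‖ ^ 2) ^ 7)⁻¹) • (z - y)) with hRst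
  have hRst_cont : ContinuousAt Rst y₀ := by
    refine (Finset.analyticAt_fun_sum (T.erase y₀) fun y hy =>
      analyticAt_const.fun_smul (analyticAt_kernel_sub y ?_)).continuousAt
    exact (Finset.ne_of_mem_erase hy).symm
  have hΦsplit : ∀ z, Φ z =
      c y₀ • ((((‖z - y₀‖ ^ 2) ^ 4)⁻¹ - ((‖z - y₀‖ ^ 2) ^ 7)⁻¹) • (z - y₀)) + Rst z := by
    intro z
    simp only [hΦ, hRst]
    exact (Finset.add_sum_erase T (fun y =>
      c y • ((((‖z - y‖ ^ 2) ^ 4)⁻¹ - ((‖z - y‖ ^ 2) ^ 7)⁻¹) • (z - y))) hy₀).symm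
  obtain ⟨ρ, hρ, hρball⟩ := Metric.continuousAt_iff.1 hRst_cont 1 one_pos
  -- isolation of `y₀` in `T`
  have hiso : ∃ ρ₂ > 0, ∀ z : EuclideanSpace ℝ (Fin 3), dist z y₀ < ρ₂ → z ≠ y₀ →
      z ∈ ((↑T : Set (EuclideanSpace ℝ (Fin 3)))ᶜ) := by
    have hopen : IsOpen ((↑(T.erase y₀) : Set (EuclideanSpace ℝ (Fin 3)))ᶜ) :=
      (Finset.finite_toSet _).isClosed.isOpen_compl
    have hmem : y₀ ∈ ((↑(T.erase y₀) : Set (EuclideanSpace ℝ (Fin 3)))ᶜ) := by simp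
    obtain ⟨ρ₂, hρ₂, hball⟩ := Metric.isOpen_iff.1 hopen y₀ hmem
    refine ⟨ρ₂, hρ₂, fun z hz hzy hzT => ?_⟩
    have hz' : z ∈ (↑(T.erase y₀) : Set (EuclideanSpace ℝ (Fin 3))) := by
      rw [Finset.mem_coe, Finset.mem_erase]
      exact ⟨hzy, Finset.mem_coe.1 hzT⟩
    exact hball (Metric.mem_ball.2 hz) hz'
  obtain ⟨ρ₂, hρ₂, hiso⟩ := hiso
  -- the test point `z = y₀ + t e`
  set B : ℝ := ‖Rst y₀‖ + 1 with hB
  have hBpos : 0 < B := by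
    rw [hB]
    positivity
  set t : ℝ := min (min ρ ρ₂) (min (1 / 2) B⁻¹) / 2 with htdef
  have hmpos : 0 < min (min ρ ρ₂) (min (1 / 2) B⁻¹) :=
    lt_min (lt_min hρ hρ₂) (lt_min (by norm_num) (inv_pos.2 hBpos))
  have htpos : 0 < t := by
    rw [htdef]
    linarith
  have htlt : t < min (min ρ ρ₂) (min (1 / 2) B⁻¹) := by
    rw [htdef]
    linarith
  have htρ : t < ρ := htlt.trans_le ((min_le_left _ _).trans (min_le_left _ _))
  have htρ₂ : t < ρ₂ := htlt.trans_le ((min_le_left _ _).trans (min_le_right _ _))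
  have hthalf : t ≤ 1 / 2 := (htlt.trans_le ((min_le_right _ _).trans (min_le_left _ _))).le
  have htB : t < B⁻¹ := htlt.trans_le ((min_le_right _ _).trans (min_le_right _ _))
  set z : EuclideanSpace ℝ (Fin 3) := y₀ + t • e with hz
  have hzy : z - y₀ = t • e := by rw [hz]; abel
  have hnorm_zy : ‖z - y₀‖ = t := by
    rw [hzy, norm_smul, henorm, mul_one, Real.norm_of_nonneg htpos.le]
  have hdist : dist z y₀ = t := by rw [dist_eq_norm, hnorm_zy]
  have hzne : z ≠ y₀ := by
    intro h
    rw [h, sub_self, norm_zero] at hnorm_zy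
    exact htpos.ne' hnorm_zy.symm
  have hzU : z ∈ ((↑T : Set (EuclideanSpace ℝ (Fin 3)))ᶜ) :=
    hiso z (by rw [hdist]; exact htρ₂) hzne
  have hΦz : Φ z = 0 := hΦU hzU
  rw [hΦsplit] at hΦz
  -- sizes: `‖K(z − y₀)‖ ≥ 1/t > B > ‖Rst z‖`
  have hc1 : ‖c y₀‖ = 1 := by
    simp only [hc]
    split_ifs <;> simp
  have hK : t⁻¹ ≤ ‖(((‖z - y₀‖ ^ 2) ^ 4)⁻¹ - ((‖z - y₀‖ ^ 2) ^ 7)⁻¹) • (z - y₀)‖ := by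
    have h0 : z - y₀ ≠ 0 := sub_ne_zero.2 hzne
    have hle : ‖z - y₀‖ ≤ 1 / 2 := by
      rw [hnorm_zy]
      exact hthalf
    calc t⁻¹ = ‖z - y₀‖⁻¹ := by rw [hnorm_zy]
      _ ≤ _ := inv_norm_le_norm_kernel h0 hle
  have hRz : ‖Rst z‖ < B := by
    have h1 : dist (Rst z) (Rst y₀) < 1 := hρball (by rw [hdist]; exact htρ)
    rw [dist_eq_norm] at h1
    have := norm_le_insert' (Rst z) (Rst y₀)
    rw [hB]
    linarith
  have heq : c y₀ • ((((‖z - y₀‖ ^ 2) ^ 4)⁻¹ - ((‖z - y₀‖ ^ 2) ^ 7)⁻¹) • (z - y₀)) = -Rst z :=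
    eq_neg_of_add_eq_zero_left hΦz
  have hnormeq : ‖(((‖z - y₀‖ ^ 2) ^ 4)⁻¹ - ((‖z - y₀‖ ^ 2) ^ 7)⁻¹) • (z - y₀)‖ = ‖Rst z‖ := by
    have := congrArg norm heq
    rwa [norm_smul, hc1, one_mul, norm_neg] at this
  have htinv : B < t⁻¹ := by
    rwa [lt_inv_comm₀ hBpos htpos]
  linarith

end Summit.AtomisticToContinuum.Crystallization.Theorems.HolmgrenBoyleLind

end
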